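import Literature.MathematicalPhysics.QuantumFieldTheory.Balaban1983to89.B8Ineq192MultiLevelBox
import Literature.MathematicalPhysics.QuantumFieldTheory.Balaban1983to89.B6Prop23MultiLevelBox

/-!
# `Balaban1983to89.B8Ineq192MultiLevelBoxP23` — T. Bałaban, *Spaces of regular gauge field configurations on a lattice and
# gauge fixing conditions*, Commun. Math. Phys. **99** (1985) 75–102 [Balaban1985RegularSpaces], **(1.91)–(1.92)** p. 91, the
# p. 93 Δ-entry and p. 92 «|Rf| ≦ B′₀|f|» **AT U₀ = 1 ON THE GENUINE `k`-LEVEL NEUMANN-BOX FAMILY, HYPOTHESIS-FREE**: the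
# argument `G` of `B8Ineq192MultiLevelBox` instantiated with THE inverse `(Q′G′²Q′*)⁻¹` of [B6] Proposition 2.3 for this family
# (`B6Prop23MultiLevelBox.prop23_multiLevelBox`, seat p21, p334402 ACCEPTED commit e15891335114, 2026-08-22T16:57Z)

statement-level skeleton of published theorems with citation tags; proofs where landed; nothing here is a claim about the Yang–Mills mass gap

CITATION HEADER (lean-in-tree rule).  Cell `lit-balaban`, unit `lit-balaban-r05` gen 44 (B8 reader/typer and fold owner; drafted gen 43 as the
announced successor step of `B8Ineq192MultiLevelBox` p333386, HOME/lit-balaban-r05/HANDOFF.md § gen 43).  WHAT IS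
REPRODUCED = SKELETON row **B8.Eq1.91** member (1.92) + the p. 93 Δ-entry and row **B8.Claim@92**, on the multi-level flat
carriers, NOW WITH NO HYPOTHESIS: `B8Ineq192MultiLevelBox` proved the kernel decay of H′ = G′²Q′*G, (1.92) and «|Rf| ≦ B′₀|f|»
for EVERY operator `G` on `𝔅` carrying the two printed properties of `(Q′G′²Q′*)⁻¹` ([B6] Prop. 2.3: the inverse identities and
the kernel bound (2.87)); `B6Prop23MultiLevelBox.prop23_multiLevelBox` (p21) supplies, for every member of the family, THE
operator `G` with `G·(Q′G′²Q′*) = 1`, `(Q′G′²Q′*)·G = 1` and (2.87).  This file is the three-line composition: for every nested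
family `D` and windowed weights there IS an operator `G` — the two-sided inverse of `Q′G′²Q′*`, hence `(Q′G′²Q′*)⁻¹` itself — such
that H′ = G′²Q′*G obeys the decay / (1.92) / «|Rf| ≦ B′₀|f|» bounds with constants depending on `d, ℓ` and the weight windows
only.  Kind «kernel-checked proof of a model instance»; theorems only; every input BY NAME; 0 sorry.

WHAT IS PRINTED (verbatim).  p. 91 [PDF 17]: *"Let us introduce the operators H′ = G′²Q′\*(Q′G′²Q′\*)⁻¹, G′ = (Δ + Q′\*aQ′)⁻¹.
(1.91) They were investigated in [4], and the following inequality can be obtained from the results of this paper: |(H′X)(x)|,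
|(∇H′X)(x)| ≦ B′₀[1, (Lʲη)⁻¹]|X| for x ∈ Ω_j, (1.92)"*; p. 92 [PDF 18]: *"… and B′₀ is an absolute constant (depending on d and L
only)."*, *"from Theorems 3.1, 3.2 of [4] it follows that |Rf| ≦ B′₀|f|"*; p. 93 [PDF 19] l. 4 «… and with ΔH′D′(u₁, λ)».  [B6]
Prop. 2.3 (2.87) p. 238; p. 235 «Of course the operator Q′G′²Q′\* is positive definite, so its inverse is well defined».

HONEST SCOPE / NOT CLAIMED.  As `B8Ineq192MultiLevelBox`: Neumann box, levels `1 … k` with `Ω₁ = X`, `A = 0` (U₀ = 1), scalar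
fibre, lattice units, `x ∈ Ω_j` read at the point's own level; constants existential (functions of `d, ℓ` and the windows;
print: «depending on d and L only» at the series' fixed `a`); thresholds «M, RM sufficiently large» explicit.  The general
(1.92) at a background `U₀ ∈ 𝔄_k` ([4] Thms 3.1–3.3) stays the typed leaf of `B8Ineq192`/`B8Ineq192Op`; rows B8.Eq1.91 /
B8.Claim@92 heads NOT changed (owner's word).  NOT summit progress, NOT continuum, NOT Clay.
-/

namespace Literature.MathematicalPhysics.QuantumFieldTheory.Balaban1983to89.B8Ineq192MultiLevelBoxP23

open Matrix
open B4Reflection242 (boxDom)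
open B4BoxCov237 (opBoxR)
open B6MultiLevelBoxOperator
open B6Geom246MultiLevelBox
open B6Ineq268MultiLevelBox
open B6Prop22DerivMultiLevelBox (dMat)
open B6Ineq243TwoLevelBox (aNext)
open B6Expansion282 (kerOp)
open B6Prop23MultiLevelBox (prop23_multiLevelBox)
open B8Ineq192MultiLevelBox

noncomputable section

variable {d : ℕ}

/-- **THE KERNEL OF (1.91) AT U₀ = 1 ON THE `k`-LEVEL BOX FAMILY DECAYS — HYPOTHESIS-FREE**: there are `ρ, B, M₀ > 0`, `N₀ ≥ 1`
(functions of `d, ℓ` and the weight windows) such that for every `k`, `M_h ≥ 3` with `L·M_h ≥ M₀`, `R ≥ 2L` with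
`R·L·M_h ≥ N₀ + 1`, every box, every nested family `D` with (2.1)–(2.2) and every windowed weight sequence there is an operator
`G` on `𝔅` which is THE two-sided inverse of `Q′G′²Q′*` (`G·(Q′G′²Q′*) = 1 = (Q′G′²Q′*)·G`) and for which `H′ = G′²Q′*G` satisfies
`|(H′δ_{y′})(x)| ≦ Be^{−ρd(y(x),y′)}`, `|(∂_μH′δ_{y′})(x)| ≦ B(Lʲ)⁻¹e^{−ρd}`, `|((−Δ^N)H′δ_{y′})(x)| ≦ B(Lʲ)⁻²e^{−ρd}` (`j` the
level of `x`). [cite: Balaban1985RegularSpaces, (1.91)–(1.92) pp.91–92, p.93 l.1–4; Balaban1984PropagatorsII, Prop. 2.3 (2.87) p.238, p.235] -/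
theorem hPrime_single_decay (d ℓ : ℕ) (hℓ : 1 ≤ ℓ) (aminus aplus a2minus a2plus : ℝ) (ha : 0 < aminus)
    (ha2 : 0 < a2minus) :
    ∃ ρ B M₀ : ℝ, ∃ N₀ : ℕ, 0 < ρ ∧ 0 < B ∧ 0 < M₀ ∧ 0 < N₀ ∧
      ∀ (k Mh R : ℕ), 3 ≤ Mh → M₀ ≤ ((ℓ : ℝ) + 1) * Mh → 2 * (ℓ + 1) ≤ R → N₀ + 1 ≤ R * ((ℓ + 1) * Mh) →
      ∀ (P : Fin (d + 1) → ℕ) (_hP : ∀ μ, 1 ≤ P μ) (D : Domains d ℓ Mh k P R) (a c : ℕ → ℝ),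
        (∀ i, 1 ≤ i → aminus ≤ a i ∧ a i ≤ aplus) → (∀ i, 1 ≤ i → a2minus ≤ c i ∧ c i ≤ a2plus) →
        (∀ i, 1 ≤ i → a (i + 1) = aNext ℓ (a i) (c i)) →
        ∃ G : Module.End ℝ (↥(bset D) → ℝ),
          G * kerOp (W D) (Xk D a) = 1 ∧ kerOp (W D) (Xk D a) * G = 1 ∧
          ∀ (x : ↥(boxDom (N0 ℓ Mh k P))) (y' : ↥(bset D)),
            |hPrimeML D a G (Pi.single y' 1) x| ≤ B * Real.exp (-(ρ * (geom D).dist (blkOf D x) y')) ∧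
            (∀ μ : Fin (d + 1), |(dMat (N0 ℓ Mh k P) μ *ᵥ hPrimeML D a G (Pi.single y' 1)) x| ≤
              B * (((ℓ : ℝ) + 1) ^ D.lev x.1)⁻¹ * Real.exp (-(ρ * (geom D).dist (blkOf D x) y'))) ∧
            |(opBoxR 1 0 0 1 (N0 ℓ Mh k P) *ᵥ hPrimeML D a G (Pi.single y' 1)) x| ≤
              B * ((((ℓ : ℝ) + 1) ^ D.lev x.1) ^ 2)⁻¹ * Real.exp (-(ρ * (geom D).dist (blkOf D x) y')) := by
  obtain ⟨δ₁, C₁, M₁, hδ₁, hC₁, hM₁, hP5⟩ := prop23_multiLevelBox d ℓ hℓ aminus aplus a2minus a2plus ha ha2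
  obtain ⟨ρ, B, M₀, N₀, hρ, hB, hM₀, hN₀, h⟩ :=
    hPrime_single_decay_of_inverse d ℓ hℓ aminus aplus a2minus a2plus ha ha2 hC₁ hδ₁
  refine ⟨ρ, B, max M₀ M₁, N₀, hρ, hB, lt_max_of_lt_left hM₀, hN₀, ?_⟩
  intro k Mh R hMh hM hR hRM P hP D a c haw hcw hac
  obtain ⟨G, h1, h2, -, -, h5, -⟩ := hP5 k Mh R ((le_max_right _ _).trans hM) hR P hP D a c haw hcw hac
  exact ⟨G, h1, h2, h k Mh R hMh ((le_max_left _ _).trans hM) hR hRM P hP D a c haw hcw hac G h5⟩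

/-- **(1.92) AT U₀ = 1 ON THE `k`-LEVEL BOX FAMILY — HYPOTHESIS-FREE**: «|(H′X)(x)|, |(∇H′X)(x)| ≦ B′₀[1, (Lʲη)⁻¹]|X| for
x ∈ Ω_j» and the p. 93 Δ-entry `|((−Δ^N)H′X)(x)| ≦ B′₀(Lʲ)⁻²|X|`, for `H′ = G′²Q′*(Q′G′²Q′*)⁻¹` with the GENUINE multi-level
`G′ = Δ′_a⁻¹`, `Q′*` and THE inverse `(Q′G′²Q′*)⁻¹` (the `G` of the statement is the two-sided inverse), and «Q′H′ = I»; constants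
depending on `d, ℓ` and the weight windows only («B′₀ is an absolute constant (depending on d and L only)»).
[cite: Balaban1985RegularSpaces, (1.92) pp.91–92, p.93 l.1–4, (1.115)–(1.116) p.96; Balaban1984PropagatorsII, Prop. 2.3 (2.87) p.238] -/
theorem ineq192_multiLevelBox (d ℓ : ℕ) (hℓ : 1 ≤ ℓ) (aminus aplus a2minus a2plus : ℝ) (ha : 0 < aminus)
    (ha2 : 0 < a2minus) :
    ∃ B₀' M₀ : ℝ, ∃ N₀ : ℕ, 0 < B₀' ∧ 0 < M₀ ∧ 0 < N₀ ∧
      ∀ (k Mh R : ℕ), 3 ≤ Mh → M₀ ≤ ((ℓ : ℝ) + 1) * Mh → 2 * (ℓ + 1) ≤ R → N₀ + 1 ≤ R * ((ℓ + 1) * Mh) →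
      ∀ (P : Fin (d + 1) → ℕ) (_hP : ∀ μ, 1 ≤ P μ) (D : Domains d ℓ Mh k P R) (a c : ℕ → ℝ),
        (∀ i, 1 ≤ i → aminus ≤ a i ∧ a i ≤ aplus) → (∀ i, 1 ≤ i → a2minus ≤ c i ∧ c i ≤ a2plus) →
        (∀ i, 1 ≤ i → a (i + 1) = aNext ℓ (a i) (c i)) →
        ∃ G : Module.End ℝ (↥(bset D) → ℝ),
          G * kerOp (W D) (Xk D a) = 1 ∧ kerOp (W D) (Xk D a) * G = 1 ∧
          (∀ X : ↥(bset D) → ℝ, QB D (hPrimeML D a G X) = X) ∧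
          ∀ (X : ↥(bset D) → ℝ) (S : ℝ), 0 ≤ S → (∀ y', |X y'| ≤ S) →
            ∀ x : ↥(boxDom (N0 ℓ Mh k P)),
              |hPrimeML D a G X x| ≤ B₀' * S ∧
              (∀ μ : Fin (d + 1), |(dMat (N0 ℓ Mh k P) μ *ᵥ hPrimeML D a G X) x| ≤
                B₀' * (((ℓ : ℝ) + 1) ^ D.lev x.1)⁻¹ * S) ∧
              |(opBoxR 1 0 0 1 (N0 ℓ Mh k P) *ᵥ hPrimeML D a G X) x| ≤
                B₀' * ((((ℓ : ℝ) + 1) ^ D.lev x.1) ^ 2)⁻¹ * S := by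
  obtain ⟨δ₁, C₁, M₁, hδ₁, hC₁, hM₁, hP5⟩ := prop23_multiLevelBox d ℓ hℓ aminus aplus a2minus a2plus ha ha2
  obtain ⟨B₀', M₀, N₀, hB, hM₀, hN₀, h⟩ :=
    ineq192_multiLevelBox_of_inverse d ℓ hℓ aminus aplus a2minus a2plus ha ha2 hC₁ hδ₁
  refine ⟨B₀', max M₀ M₁, N₀, hB, lt_max_of_lt_left hM₀, hN₀, ?_⟩
  intro k Mh R hMh hM hR hRM P hP D a c haw hcw hac
  obtain ⟨G, h1, h2, -, -, h5, -⟩ := hP5 k Mh R ((le_max_right _ _).trans hM) hR P hP D a c haw hcw hac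
  exact ⟨G, h1, h2, fun X => QB_hPrimeML h2 X,
    h k Mh R hMh ((le_max_left _ _).trans hM) hR hRM P hP D a c haw hcw hac G h5⟩

/-- **«|Rf| ≦ B′₀|f|» (p. 92) AT U₀ = 1 ON THE `k`-LEVEL BOX FAMILY — HYPOTHESIS-FREE**, for the projection
`R = 1 − G′Q′*(Q′G′²Q′*)⁻¹Q′G′` of [4] (3.25) (`rProjML` with THE inverse), together with its projection identities
`Q′G′R = 0`, `R·G′Q′* = 0`, `R² = R`. [cite: Balaban1985RegularSpaces, p.92, (1.27) p.80; Balaban1985BackgroundPropagators, (3.25) p.394; Balaban1984PropagatorsII, Prop. 2.3 (2.87) p.238] -/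
theorem rProjML_sup_bound (d ℓ : ℕ) (hℓ : 1 ≤ ℓ) (aminus aplus a2minus a2plus : ℝ) (ha : 0 < aminus)
    (ha2 : 0 < a2minus) :
    ∃ B₀' M₀ : ℝ, ∃ N₀ : ℕ, 0 < B₀' ∧ 0 < M₀ ∧ 0 < N₀ ∧
      ∀ (k Mh R : ℕ), 3 ≤ Mh → M₀ ≤ ((ℓ : ℝ) + 1) * Mh → 2 * (ℓ + 1) ≤ R → N₀ + 1 ≤ R * ((ℓ + 1) * Mh) →
      ∀ (P : Fin (d + 1) → ℕ) (_hP : ∀ μ, 1 ≤ P μ) (D : Domains d ℓ Mh k P R) (a c : ℕ → ℝ),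
        (∀ i, 1 ≤ i → aminus ≤ a i ∧ a i ≤ aplus) → (∀ i, 1 ≤ i → a2minus ≤ c i ∧ c i ≤ a2plus) →
        (∀ i, 1 ≤ i → a (i + 1) = aNext ℓ (a i) (c i)) →
        ∃ G : Module.End ℝ (↥(bset D) → ℝ),
          G * kerOp (W D) (Xk D a) = 1 ∧ kerOp (W D) (Xk D a) * G = 1 ∧
          (∀ f, QB D (gml (N0 ℓ Mh k P) ℓ k D.lev a *ᵥ rProjML D a G f) = 0) ∧
          (∀ Xc, rProjML D a G (gml (N0 ℓ Mh k P) ℓ k D.lev a *ᵥ QsB D Xc) = 0) ∧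
          (∀ f, rProjML D a G (rProjML D a G f) = rProjML D a G f) ∧
          ∀ (f : ↥(boxDom (N0 ℓ Mh k P)) → ℝ) (S : ℝ), 0 ≤ S → (∀ z, |f z| ≤ S) →
            ∀ x : ↥(boxDom (N0 ℓ Mh k P)), |rProjML D a G f x| ≤ B₀' * S := by
  obtain ⟨δ₁, C₁, M₁, hδ₁, hC₁, hM₁, hP5⟩ := prop23_multiLevelBox d ℓ hℓ aminus aplus a2minus a2plus ha ha2
  obtain ⟨B₀', M₀, N₀, hB, hM₀, hN₀, h⟩ :=
    rProjML_sup_bound_of_inverse d ℓ hℓ aminus aplus a2minus a2plus ha ha2 hC₁ hδ₁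
  refine ⟨B₀', max M₀ M₁, N₀, hB, lt_max_of_lt_left hM₀, hN₀, ?_⟩
  intro k Mh R hMh hM hR hRM P hP D a c haw hcw hac
  obtain ⟨G, h1, h2, -, -, h5, -⟩ := hP5 k Mh R ((le_max_right _ _).trans hM) hR P hP D a c haw hcw hac
  exact ⟨G, h1, h2, fun f => QB_gml_rProjML h2 f, fun Xc => rProjML_gml_QsB h1 Xc, fun f => rProjML_idem h2 f,
    h k Mh R hMh ((le_max_left _ _).trans hM) hR hRM P hP D a c haw hcw hac G h5⟩

end

end Literature.MathematicalPhysics.QuantumFieldTheory.Balaban1983to89.B8Ineq192MultiLevelBoxP23
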